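import Summits.QuantumFields.BalabanUV.T4Continuum.Support.DirichletStarSlabLayer
import Summits.QuantumFields.BalabanUV.T4Continuum.Support.RegionNormPairingTools
import Summits.QuantumFields.BalabanUV.T4Continuum.Support.RegionGaugeSliceOrthRegion

/-!
# T⁴ programme, spine node NE2 (U1a), sub-row Δ1 «NE2⁰-Dirichlet» — THE OUTER LAYER IS FAR FROM AN EIGENVECTOR: the layer charge
# `ψ` (first interior layer) is almost untouched by the region's gauge projection, `‖P(Ω₀)ψ‖² ≤ σ₀⁻¹·n⁻²·‖ψ‖²`, so the slab field
# `slabA + c·χ` has energy `≥ c²·(n² − σ₀⁻¹)·‖χ‖²` under the faithful operator `Δ_a(Ω₀)`, while `‖Δ_a(Ω₀)χ‖ ≤ (2√d·n² + a)‖χ‖`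

NE2 formalisation swarm `b2b-balaban-t4-ne2-formalise-*`, LEAF PROVER 02 (gen 7), supplier item «Δ1-VEC-W3̃-SLAB-NOGO» (owner ruling R29
successor item (iii), NEGATIVE side), file 2 of 3 (+ tools `Support/RegionNormPairingTools`), on file 1 `Support/DirichletStarSlabLayer` (`chi`, `psi`, `curlR_chi`,
`gradR_conjTranspose_chi : ∂_Ωᴴχ = n·ψ`, the counts).  Elementary lattice analysis at ONE level `n` on the one-block slab `slabS M i`
(`3 ≤ M i`), for the owner's objects `regionDeltaA n M a a′ S = curlRᴴcurlR + gradR·R(Ω₀)·gradRᴴ + a n^d·avgRᴴavgR` (p223093 / p222530),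
`R(Ω₀) = gaugeR G′_Ω Q′_Ω = 1 − P`, `P = gaugeP G′_Ω Q′_Ω` (p221352), `σ₀ = sigma0 d a′` of `RegionScalarCompression.coercive_KcompR` (p222542):

 * §1 norms: `‖gradR f‖² ≤ 4d·n²·‖f‖²` (any region), `‖avgR A‖² ≤ n^{−d}‖A‖²`, `‖avgRᴴμ‖² ≤ n^{−d}‖μ‖²`;
 * §2 **`nsq_gaugeP_psi_le : ‖Pψ‖² ≤ σ₀⁻¹·n⁻²·‖ψ‖²`** — `Pψ = G′Q′ᴴω` is a Dirichlet function on `Ω` with `Δ′_a(Pψ) = Q′ᴴω`; its values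
   on the first layer are `n⁻¹`× its inward normal differences (`nsq_layer_le`: `Σ_{layer}|φ|² ≤ n⁻²‖gradR φ‖²`), its gradient energy is
   `≤ ‖φ‖·‖Q′ᴴω‖ ≤ σ₀⁻¹‖φ‖²` (`Q′Q′ᴴ = n^{−d}`, `K_Ω ≥ σ₀²`), and `‖Pψ‖² = Re⟨Pψ, ψ⟩ ≤ √‖ψ‖²·√(Σ_{layer}|Pψ|²)`; hence
   **`nsq_gaugeR_psi_ge : (1 − σ₀⁻¹n⁻²)‖ψ‖² ≤ ‖R(Ω₀)ψ‖²`**;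
 * §3 **`energy_ge`**: for every field `v` with `gradRᴴ v = c·ψ` (`c` real): `c²·(1 − σ₀⁻¹n⁻²)·‖ψ‖² ≤ Re⟨v, Δ_a(Ω₀)v⟩`;
 * §4 **`sqrt_nsq_D_slabA_le : ‖Δ_a(Ω₀)slabA‖ ≤ a‖slabA‖`**, **`sqrt_nsq_D_chi_le : ‖Δ_a(Ω₀)χ‖ ≤ (2√d·n² + a)·‖χ‖`** (curl-free fields: only the gauge and
   mass parts act).

HONEST FRAMING (T4-DAG p. 1).  MODEL level (`U = 1`, ONE region — the one-block slab —, ONE averaging scale, finite torus, operator norm);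
statements / constants OURS ([folklore]); no displayed hypothesis of the lineage is discharged or used; NE2 (U1a) NOT proved; spine 0/9 unchanged;
NOT [B9] (3.16)/(3.23)–(3.27) as printed; NOT infinite volume, NOT a mass gap, NOT the Clay problem, NOT summit progress.  HONEST DEPENDENCY:
continuum YM on T⁴ ⇐ BetaPertH ∧ nine spine estimates (0/9 proved); BetaPertH ⇐ (D1) ∧ (D4) ∧ CAP+tail; G-an2-4 gates asym, D1 and NE2/3/4.
No `sorry`.
-/

noncomputable section

open scoped BigOperators ComplexConjugate Matrix Matrix.Norms.L2Operator
open Finset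

namespace Summit.QuantumFields.BalabanUV.T4Continuum.DirichletStarSlabLayerEnergy

open Literature.MathematicalPhysics.QuantumFieldTheory.Balaban1983to89.B5Prop11Plancherel (Tor fine unitVec)
open Literature.MathematicalPhysics.QuantumFieldTheory.Balaban1983to89.B5Prop11Lower (nsq nsq_nonneg star_dotProduct_self
  norm_star_dotProduct_le)
open Literature.MathematicalPhysics.QuantumFieldTheory.Balaban1983to89.B5Action121 (GradOp GradOp_mulVec sdiff_mulVec
  dotProduct_mulVec_eq_star_conjTranspose_mulVec)
open Literature.MathematicalPhysics.QuantumFieldTheory.Balaban1983to89.B5Block118 (QvOp)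
open Summit.QuantumFields.BalabanUV.T4Continuum
open Summit.QuantumFields.BalabanUV.T4Continuum.SubtypeCompression (ext ext_apply_of ext_apply_of_not nsq_ext)
open Summit.QuantumFields.BalabanUV.T4Continuum.ScalarBlockPoincare (nsq_smul nsq_add_le)
open Summit.QuantumFields.BalabanUV.T4Continuum.BalabanBlockPoincare (nsq_mulVec_le_rect)
open Summit.QuantumFields.BalabanUV.T4Continuum.ScalarAveragedPropagator (re_star_dotProduct_le)
open Summit.QuantumFields.BalabanUV.T4Continuum.ScalarAveragedCompression (sigma0 sigma0_pos)
open Summit.QuantumFields.BalabanUV.T4Continuum.CovariantBlockAveraging (opNorm_QvOp_le)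
open Summit.QuantumFields.BalabanUV.T4Continuum.RegionGaugeProjection (gramK gaugeP gaugeR gaugeP_isHermitian gaugeP_mul_gaugeP
  opNorm_gaugeR_le form_gramK nsq_QH_mulVec nsq_sub_eq_of_fixed)
open Summit.QuantumFields.BalabanUV.T4Continuum.RegionGaugeSlice (form_gram)
open Summit.QuantumFields.BalabanUV.T4Continuum.RegionScalarCompression (QOm GOm GOm_isHermitian DOm_mul_GOm isUnit_det_gramK_region
  KcompR KcompR_eq_smul_gramK coercive_KcompR nsq_QOm_mulVec_le)
open Summit.QuantumFields.BalabanUV.T4Continuum.RegionGaugeSliceOrthRegion (QOm_mul_conjTranspose)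
open Summit.QuantumFields.BalabanUV.T4Continuum.RegionGaugeFixedVector (starReg curlR gradR avgR regionDeltaA regionDeltaA_eq
  form_regionDeltaA gradR_conjTranspose_mul_gradR toBlock_PiS)
open Summit.QuantumFields.BalabanUV.T4Continuum.RegionGaugeFixedVectorFlat (avgR_mulVec)
open Summit.QuantumFields.BalabanUV.T4Continuum.RegionGaugeFixedVectorTop (avgR_conjTranspose_mulVec gradR_mulVec)
open Summit.QuantumFields.BalabanUV.T4Continuum.DirichletDirectionalBesov (sqrt_nsq_add_le sqrt_nsq_smul nsq_mono)
open Summit.QuantumFields.BalabanUV.T4Continuum.DirichletStarSlabMode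
open Summit.QuantumFields.BalabanUV.T4Continuum.DirichletStarSlabLayer
open Summit.QuantumFields.BalabanUV.T4Continuum.RegionNormPairingTools
open Summit.QuantumFields.BalabanUV.Beta.GAN24.DirichletBoxCompression (DOm)
open Summit.QuantumFields.BalabanUV.Beta.GAN24.DirichletBoxTrace (blockReg)

variable {d : ℕ} (n : ℕ) [NeZero n] (M : Fin d → ℕ) [hM : ∀ μ, NeZero (M μ)]

/-! ## §2 The first interior layer is almost untouched by the region's gauge projection -/

section Layer

variable (i : Fin d) (a' : ℝ)

/-- the INWARD NORMAL BOND `(x − e_i, i)` of a site `x ∈ Ω` is a star bond. [folklore] -/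
def inb (x : {x // blockReg n M (slabS M i) x}) : {b // starReg n M (slabS M i) b} :=
  ⟨(x.1 - unitVec (fine n M) i, i), Or.inr (by rw [sub_add_cancel]; exact x.2)⟩

/-- `x ↦ (x − e_i, i)` is injective. [folklore] -/
theorem inb_injective : Function.Injective (inb n M i) := by
  intro x y h
  have h1 := congrArg (fun b : {b // starReg n M (slabS M i) b} => b.1.1) h
  simp only [inb] at h1
  exact Subtype.ext (sub_left_injective h1)

/-- **the inward normal difference at a first-layer site is the value there**: `(gradR φ)(x − e_i, i) = n·φ(x)` when `(x_i).val = 0`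
(the site `x − e_i` lies outside `Ω`: Dirichlet). [folklore] -/
theorem gradR_inb (hMi : 3 ≤ M i) (φ : {x // blockReg n M (slabS M i) x} → ℂ) (x : {x // blockReg n M (slabS M i) x})
    (hx : (x.1 i).val = 0) : (gradR n M (slabS M i) *ᵥ φ) (inb n M i x) = (n : ℂ) * φ x := by
  have h3 := three_mul_le n M i hMi
  have hn : 1 ≤ n := Nat.pos_of_ne_zero (NeZero.ne n)
  have hN : 1 < fine n M i := by omega
  haveI : Fact (1 < fine n M i) := ⟨hN⟩
  rw [gradR_mulVec]
  show (GradOp (fine n M) (n : ℂ) *ᵥ ext (blockReg n M (slabS M i)) φ) (x.1 - unitVec (fine n M) i, i) = _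
  rw [GradOp_mulVec, sdiff_mulVec, sub_add_cancel, ext_apply_of _ _ x]
  have hout : ¬ blockReg n M (slabS M i) (x.1 - unitVec (fine n M) i) := by
    rw [blockReg_slab_iff]
    have e : (x.1 - unitVec (fine n M) i) i = x.1 i - 1 := by simp [unitVec]
    rw [e]
    have hx0 : x.1 i = 0 := by rw [← ZMod.val_eq_zero]; exact hx
    rw [hx0, zero_sub, ZMod.val_neg_of_ne_zero, ZMod.val_one]
    omega
  rw [ext_apply_of_not _ _ hout, sub_zero]

/-- **THE DIRICHLET LAYER BOUND**: `Σ_{first layer} |φ|² ≤ n⁻²·‖gradR φ‖²` for every Dirichlet scalar `φ` on the slab. [folklore] -/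
theorem nsq_layer_le (hMi : 3 ≤ M i) (φ : {x // blockReg n M (slabS M i) x} → ℂ) :
    nsq (fun x => psi n M i x * φ x) ≤ ((n : ℝ) ^ 2)⁻¹ * nsq (gradR n M (slabS M i) *ᵥ φ) := by
  have hn : (0 : ℝ) < n := by exact_mod_cast Nat.pos_of_ne_zero (NeZero.ne n)
  have hn2 : (0 : ℝ) < (n : ℝ) ^ 2 := by positivity
  set g := gradR n M (slabS M i) *ᵥ φ with hg
  -- pointwise: `|ψ_x φ_x|² ≤ n⁻²·|g (inb x)|²`
  have hpt : ∀ x : {x // blockReg n M (slabS M i) x}, ‖psi n M i x * φ x‖ ^ 2 ≤ ((n : ℝ) ^ 2)⁻¹ * ‖g (inb n M i x)‖ ^ 2 := by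
    intro x
    by_cases hx : (x.1 i).val = 0
    · have e1 : psi n M i x = 1 := by simp only [psi, hx, if_true]
      rw [e1, one_mul, hg, gradR_inb n M i hMi φ x hx, norm_mul, Complex.norm_natCast, mul_pow, ← mul_assoc,
        inv_mul_cancel₀ hn2.ne', one_mul]
    · simp only [psi, hx, if_false, zero_mul, norm_zero, ne_eq, OfNat.ofNat_ne_zero, not_false_eq_true, zero_pow]
      positivity
  calc nsq (fun x => psi n M i x * φ x) = ∑ x, ‖psi n M i x * φ x‖ ^ 2 := rfl
    _ ≤ ∑ x, ((n : ℝ) ^ 2)⁻¹ * ‖g (inb n M i x)‖ ^ 2 := Finset.sum_le_sum fun x _ => hpt x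
    _ = ((n : ℝ) ^ 2)⁻¹ * ∑ x, ‖g (inb n M i x)‖ ^ 2 := by rw [Finset.mul_sum]
    _ ≤ ((n : ℝ) ^ 2)⁻¹ * nsq g := by
        refine mul_le_mul_of_nonneg_left ?_ (inv_nonneg.mpr hn2.le)
        rw [← Finset.sum_image (f := fun b => ‖g b‖ ^ 2) (fun x _ y _ h => inb_injective n M i h)]
        exact Finset.sum_le_sum_of_subset_of_nonneg (Finset.subset_univ _) fun _ _ _ => sq_nonneg _

/-- `⟨φ, ψ⟩ = ⟨ψ·φ, ψ⟩` (`ψ` is a `{0,1}`-indicator). [folklore] -/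
theorem star_dotProduct_psi (φ : {x // blockReg n M (slabS M i) x} → ℂ) :
    star φ ⬝ᵥ psi n M i = star (fun x => psi n M i x * φ x) ⬝ᵥ psi n M i := by
  simp only [dotProduct, Pi.star_apply, star_mul']
  refine Finset.sum_congr rfl fun x _ => ?_
  simp only [psi]
  split_ifs <;> simp

/-- the energy identity of the region scalar operator: `Re⟨φ, Δ′_{a,Ω}φ⟩ = ‖gradR φ‖² + a′n^d‖Q′_Ωφ‖²`.
[cite: Balaban1985BackgroundPropagators, (3.24) p.394 (shape)] [folklore] -/
theorem re_form_DOm (S : Tor M → Prop) [DecidablePred S] (φ : {x // blockReg n M S x} → ℂ) :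
    (star φ ⬝ᵥ (DOm n M a' (blockReg n M S) *ᵥ φ)).re = nsq (gradR n M S *ᵥ φ) + a' * (n : ℝ) ^ d * nsq (QOm n M S *ᵥ φ) := by
  have e : DOm n M a' (blockReg n M S) = (gradR n M S)ᴴ * gradR n M S + ((a' : ℂ) * (n : ℂ) ^ d) • ((QOm n M S)ᴴ * QOm n M S) := by
    unfold DOm ScalarAveragedPropagator.DeltaPs
    rw [SubtypeCompression.toBlock_add, SubtypeCompression.toBlock_smul, toBlock_PiS, gradR_conjTranspose_mul_gradR, smul_smul]
  rw [e, Matrix.add_mulVec, Matrix.smul_mulVec, dotProduct_add, dotProduct_smul, form_gram, form_gram, Complex.add_re, smul_eq_mul]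
  have h2 : (((a' : ℂ) * (n : ℂ) ^ d) * ((nsq (QOm n M S *ᵥ φ) : ℝ) : ℂ)).re = a' * (n : ℝ) ^ d * nsq (QOm n M S *ᵥ φ) := by
    have : ((a' : ℂ) * (n : ℂ) ^ d) * ((nsq (QOm n M S *ᵥ φ) : ℝ) : ℂ) = (((a' * (n : ℝ) ^ d * nsq (QOm n M S *ᵥ φ)) : ℝ) : ℂ) := by
      push_cast; ring
    rw [this, Complex.ofReal_re]
  rw [Complex.ofReal_re, h2]

/-- **THE GAUGE PROJECTION BARELY SEES THE LAYER CHARGE**: `‖P(Ω₀)ψ‖² ≤ σ₀⁻¹·n⁻²·‖ψ‖²`. [folklore] -/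
theorem nsq_gaugeP_psi_le (hMi : 3 ≤ M i) (ha' : 0 < a') :
    nsq (gaugeP (GOm n M a' (slabS M i)) (QOm n M (slabS M i)) *ᵥ psi n M i)
      ≤ (sigma0 d a')⁻¹ * ((n : ℝ) ^ 2)⁻¹ * nsq (psi n M i) := by
  have hn : (0 : ℝ) < n := by exact_mod_cast Nat.pos_of_ne_zero (NeZero.ne n)
  have hnd : (0 : ℝ) < (n : ℝ) ^ d := pow_pos hn d
  have hσ : 0 < sigma0 d a' := sigma0_pos (d := d) ha'
  set S := slabS M i with hS
  set G := GOm n M a' S with hG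
  set Q := QOm n M S with hQ
  set P := gaugeP G Q with hP
  set ψ := psi n M i with hψ
  set φ := P *ᵥ ψ with hφ
  have hGh : G.IsHermitian := GOm_isHermitian n M a' S
  have hK : IsUnit (gramK G Q).det := isUnit_det_gramK_region n M a' S ha'
  have hPh : P.IsHermitian := gaugeP_isHermitian G Q hGh
  have hPP : P * P = P := gaugeP_mul_gaugeP G Q hK
  -- `φ = G Qᴴ ω`, `Δ′_a φ = Qᴴ ω`
  set ω := (gramK G Q)⁻¹ *ᵥ (Q *ᵥ (G *ᵥ ψ)) with hω
  have hφω : φ = G *ᵥ (Qᴴ *ᵥ ω) := by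
    simp only [hφ, hP, hω, gaugeP, Matrix.mulVec_mulVec, Matrix.mul_assoc]
  have hDφ : DOm n M a' (blockReg n M S) *ᵥ φ = Qᴴ *ᵥ ω := by
    rw [hφω, Matrix.mulVec_mulVec, hG, DOm_mul_GOm n M a' S ha', Matrix.one_mulVec]
  -- (g) `nsq ω ≤ σ₀⁻²·n^d·nsq φ`
  have hωφ : (sigma0 d a') ^ 2 * nsq ω ≤ (n : ℝ) ^ d * nsq φ := by
    have h1 := coercive_KcompR n M a' S ha' ω
    have h2 : (star ω ⬝ᵥ (KcompR n M a' S *ᵥ ω)).re = (n : ℝ) ^ d * nsq φ := by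
      rw [KcompR_eq_smul_gramK, Matrix.smul_mulVec, dotProduct_smul, smul_eq_mul, ← hG, ← hQ, form_gramK G Q hGh, ← hφω]
      have : ((n : ℂ) ^ d) * ((nsq φ : ℝ) : ℂ) = ((((n : ℝ) ^ d * nsq φ) : ℝ) : ℂ) := by push_cast; ring
      rw [this, Complex.ofReal_re]
    rw [h2] at h1; exact h1
  -- (f) `nsq (Qᴴ ω) = n^{−d}·nsq ω`
  have hQω : nsq (Qᴴ *ᵥ ω) = ((n : ℝ) ^ d)⁻¹ * nsq ω := nsq_QH_mulVec Q (QOm_mul_conjTranspose n M S) ω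
  -- (d)+(e) `nsq (gradR φ) ≤ Re⟨φ, Δ′_aφ⟩ ≤ √nsq φ·√nsq(Qᴴω)`
  have hgrad : nsq (gradR n M S *ᵥ φ) ≤ Real.sqrt (nsq φ) * Real.sqrt (nsq (Qᴴ *ᵥ ω)) := by
    have h1 : nsq (gradR n M S *ᵥ φ) ≤ (star φ ⬝ᵥ (DOm n M a' (blockReg n M S) *ᵥ φ)).re := by
      rw [re_form_DOm]
      exact le_add_of_nonneg_right (by have := nsq_nonneg (QOm n M S *ᵥ φ); positivity)
    rw [hDφ] at h1
    exact h1.trans (re_star_dotProduct_le _ _)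
  -- hence `nsq (gradR φ) ≤ σ₀⁻¹·nsq φ`
  have hgrad' : nsq (gradR n M S *ᵥ φ) ≤ (sigma0 d a')⁻¹ * nsq φ := by
    have h3 : nsq (Qᴴ *ᵥ ω) ≤ ((sigma0 d a')⁻¹) ^ 2 * nsq φ := by
      rw [hQω]
      have h4 : nsq ω ≤ ((sigma0 d a') ^ 2)⁻¹ * ((n : ℝ) ^ d * nsq φ) := by
        rw [le_inv_mul_iff₀ (pow_pos hσ 2)]; exact hωφ
      calc ((n : ℝ) ^ d)⁻¹ * nsq ω ≤ ((n : ℝ) ^ d)⁻¹ * (((sigma0 d a') ^ 2)⁻¹ * ((n : ℝ) ^ d * nsq φ)) :=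
            mul_le_mul_of_nonneg_left h4 (inv_nonneg.mpr hnd.le)
        _ = ((sigma0 d a')⁻¹) ^ 2 * nsq φ := by field_simp
    have h5 : Real.sqrt (nsq (Qᴴ *ᵥ ω)) ≤ (sigma0 d a')⁻¹ * Real.sqrt (nsq φ) := by
      rw [← Real.sqrt_sq (inv_nonneg.mpr hσ.le), ← Real.sqrt_mul (sq_nonneg _)]
      exact Real.sqrt_le_sqrt h3
    calc nsq (gradR n M S *ᵥ φ) ≤ Real.sqrt (nsq φ) * Real.sqrt (nsq (Qᴴ *ᵥ ω)) := hgrad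
      _ ≤ Real.sqrt (nsq φ) * ((sigma0 d a')⁻¹ * Real.sqrt (nsq φ)) := mul_le_mul_of_nonneg_left h5 (Real.sqrt_nonneg _)
      _ = (sigma0 d a')⁻¹ * nsq φ := by rw [mul_left_comm, Real.mul_self_sqrt (nsq_nonneg _)]
  -- (h) the layer part of `φ`
  have hlay : nsq (fun x => ψ x * φ x) ≤ ((n : ℝ) ^ 2)⁻¹ * ((sigma0 d a')⁻¹ * nsq φ) :=
    (nsq_layer_le n M i hMi φ).trans (mul_le_mul_of_nonneg_left hgrad' (inv_nonneg.mpr (by positivity)))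
  -- (a)+(b) `nsq φ = Re⟨φ, ψ⟩ ≤ √nsq ψ · √(layer part)`
  have hφψ : nsq φ ≤ Real.sqrt (nsq (fun x => ψ x * φ x)) * Real.sqrt (nsq ψ) := by
    have e1 : ((nsq φ : ℝ) : ℂ) = star φ ⬝ᵥ ψ := by
      have h := nsq_sub_eq_of_fixed hPh hPP ψ 0 (Matrix.mulVec_zero _)
      rw [sub_zero, sub_zero] at h
      -- `⟨Pψ, ψ⟩ = ⟨Pψ, Pψ⟩ + ⟨Pψ, ψ − Pψ⟩`, the second vanishes
      have e2 : star φ ⬝ᵥ ψ = star (Pᴴ *ᵥ φ) ⬝ᵥ ψ := by rw [hPh.eq, hφ, Matrix.mulVec_mulVec, hPP]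
      rw [e2, ← dotProduct_mulVec_eq_star_conjTranspose_mulVec, ← hφ, star_dotProduct_self]
    have e3 : (star φ ⬝ᵥ ψ).re = nsq φ := by rw [← e1, Complex.ofReal_re]
    rw [← e3, star_dotProduct_psi]
    exact re_star_dotProduct_le _ _
  -- square and divide
  by_cases h0 : nsq φ = 0
  · rw [h0]; have := nsq_nonneg ψ; positivity
  · have hpos : 0 < nsq φ := lt_of_le_of_ne (nsq_nonneg _) (Ne.symm h0)
    have hsq : nsq φ ^ 2 ≤ nsq (fun x => ψ x * φ x) * nsq ψ := by
      have := hφψ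
      calc nsq φ ^ 2 ≤ (Real.sqrt (nsq (fun x => ψ x * φ x)) * Real.sqrt (nsq ψ)) ^ 2 := pow_le_pow_left₀ (nsq_nonneg _) hφψ 2
        _ = nsq (fun x => ψ x * φ x) * nsq ψ := by rw [mul_pow, Real.sq_sqrt (nsq_nonneg _), Real.sq_sqrt (nsq_nonneg _)]
    have h6 : nsq φ ^ 2 ≤ ((n : ℝ) ^ 2)⁻¹ * ((sigma0 d a')⁻¹ * nsq φ) * nsq ψ :=
      hsq.trans (mul_le_mul_of_nonneg_right hlay (nsq_nonneg _))
    have h7 : nsq φ * nsq φ ≤ nsq φ * ((sigma0 d a')⁻¹ * ((n : ℝ) ^ 2)⁻¹ * nsq ψ) := by rw [← sq]; linarith [h6]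
    exact le_of_mul_le_mul_left h7 hpos

/-- **`(1 − σ₀⁻¹n⁻²)·‖ψ‖² ≤ ‖R(Ω₀)ψ‖²`**. [folklore] -/
theorem nsq_gaugeR_psi_ge (hMi : 3 ≤ M i) (ha' : 0 < a') :
    (1 - (sigma0 d a')⁻¹ * ((n : ℝ) ^ 2)⁻¹) * nsq (psi n M i)
      ≤ nsq (gaugeR (GOm n M a' (slabS M i)) (QOm n M (slabS M i)) *ᵥ psi n M i) := by
  set G := GOm n M a' (slabS M i)
  set Q := QOm n M (slabS M i)
  have hPh := gaugeP_isHermitian G Q (GOm_isHermitian n M a' (slabS M i))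
  have hPP := gaugeP_mul_gaugeP G Q (isUnit_det_gramK_region n M a' (slabS M i) ha')
  have h := nsq_sub_eq_of_fixed hPh hPP (psi n M i) 0 (Matrix.mulVec_zero _)
  rw [sub_zero, sub_zero] at h
  have e : gaugeR G Q *ᵥ psi n M i = psi n M i - gaugeP G Q *ᵥ psi n M i := by
    rw [gaugeR, Matrix.sub_mulVec, Matrix.one_mulVec]
  rw [e]
  have h2 := nsq_gaugeP_psi_le n M i a' hMi ha'
  nlinarith [h, h2]

end Layer

/-! ## §3 Energy of fields whose divergence is a multiple of the layer charge -/

section Energy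

variable (i : Fin d) (a a' : ℝ)

/-- **`c²·(1 − σ₀⁻¹n⁻²)·‖ψ‖² ≤ Re⟨v, Δ_a(Ω₀)v⟩`** whenever `∂_Ωᴴ v = c·ψ` (`c` real) — the gauge part of the form alone. [folklore] -/
theorem energy_ge (hMi : 3 ≤ M i) (ha : 0 ≤ a) (ha' : 0 < a') {c : ℝ} (v : {b // starReg n M (slabS M i) b} → ℂ)
    (hv : (gradR n M (slabS M i))ᴴ *ᵥ v = fun x => (c : ℂ) * psi n M i x) :
    c ^ 2 * ((1 - (sigma0 d a')⁻¹ * ((n : ℝ) ^ 2)⁻¹) * nsq (psi n M i))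
      ≤ (star v ⬝ᵥ (regionDeltaA n M a a' (slabS M i) *ᵥ v)).re := by
  have hnd : (0 : ℝ) ≤ (n : ℝ) ^ d := pow_nonneg (Nat.cast_nonneg _) d
  rw [form_regionDeltaA n M a a' (slabS M i) ha' v, hv]
  have e : (fun x => (c : ℂ) * psi n M i x) = (c : ℂ) • psi n M i := rfl
  rw [e, Matrix.mulVec_smul, nsq_smul, Complex.norm_real, Real.norm_eq_abs, sq_abs]
  have h1 := nsq_gaugeR_psi_ge n M i a' hMi ha'
  have h2 := nsq_nonneg (curlR n M (slabS M i) *ᵥ v)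
  have h3 := nsq_nonneg (avgR n M (slabS M i) *ᵥ v)
  nlinarith [mul_le_mul_of_nonneg_left h1 (sq_nonneg c), mul_nonneg (mul_nonneg ha hnd) h3]

end Energy

/-! ## §4 The operator on the curl-free normal fields `slabA`, `χ` -/

section Apply

variable (i : Fin d) (a a' : ℝ)

/-- on a curl-free field only the gauge and mass parts act. [folklore] -/
theorem regionDeltaA_mulVec_of_curl_zero (S : Tor M → Prop) [DecidablePred S] (v : {b // starReg n M S b} → ℂ)
    (hc : curlR n M S *ᵥ v = 0) :
    regionDeltaA n M a a' S *ᵥ v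
      = gradR n M S *ᵥ (gaugeR (GOm n M a' S) (QOm n M S) *ᵥ ((gradR n M S)ᴴ *ᵥ v))
          + (((a * (n : ℝ) ^ d : ℝ)) : ℂ) • ((avgR n M S)ᴴ *ᵥ (avgR n M S *ᵥ v)) := by
  rw [regionDeltaA_eq, Matrix.add_mulVec, Matrix.add_mulVec, Matrix.smul_mulVec, ← Matrix.mulVec_mulVec, ← Matrix.mulVec_mulVec,
    ← Matrix.mulVec_mulVec, ← Matrix.mulVec_mulVec, hc, Matrix.mulVec_zero, zero_add]

/-- **`‖Δ_a(Ω₀)·slabA‖ ≤ a·‖slabA‖`** (curl and divergence vanish; `‖a n^d avgRᴴavgR‖ ≤ a`). [folklore] -/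
theorem sqrt_nsq_D_slabA_le (hMi : 3 ≤ M i) (ha : 0 ≤ a) :
    Real.sqrt (nsq (regionDeltaA n M a a' (slabS M i) *ᵥ slabA n M i)) ≤ a * Real.sqrt (nsq (slabA n M i)) := by
  rw [regionDeltaA_mulVec_of_curl_zero n M a a' (slabS M i) _ (curlR_slabA n M i hMi), gradR_conjTranspose_slabA n M i hMi,
    Matrix.mulVec_zero, Matrix.mulVec_zero, zero_add]
  exact sqrt_nsq_mass_le n M (slabS M i) ha _

/-- **`‖Δ_a(Ω₀)·χ‖ ≤ (2√d·n² + a)·‖χ‖`** (curl vanishes, `∂_Ωᴴχ = nψ`, `‖R(Ω₀)‖ ≤ 1`, `‖gradR‖ ≤ 2√d·n`, `‖ψ‖ = ‖χ‖`). [folklore] -/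
theorem sqrt_nsq_D_chi_le (hMi : 3 ≤ M i) (ha : 0 ≤ a) (ha' : 0 < a') :
    Real.sqrt (nsq (regionDeltaA n M a a' (slabS M i) *ᵥ chi n M i))
      ≤ (2 * Real.sqrt d * (n : ℝ) ^ 2 + a) * Real.sqrt (nsq (chi n M i)) := by
  have hn : (0 : ℝ) ≤ n := Nat.cast_nonneg n
  rw [regionDeltaA_mulVec_of_curl_zero n M a a' (slabS M i) _ (curlR_chi n M i hMi), gradR_conjTranspose_chi n M i hMi]
  refine (sqrt_nsq_add_le _ _).trans ?_
  have e : (fun x => (n : ℂ) * psi n M i x) = (n : ℂ) • psi n M i := rfl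
  have h1 : Real.sqrt (nsq (gradR n M (slabS M i) *ᵥ (gaugeR (GOm n M a' (slabS M i)) (QOm n M (slabS M i)) *ᵥ fun x => (n : ℂ) * psi n M i x)))
      ≤ 2 * Real.sqrt d * (n : ℝ) ^ 2 * Real.sqrt (nsq (chi n M i)) := by
    refine (sqrt_nsq_gradR_gaugeR_le n M (slabS M i) a' ha' _).trans ?_
    have hpc : nsq (psi n M i) = nsq (chi n M i) := by rw [nsq_psi n M i hMi, nsq_chi n M i hMi]
    rw [e, sqrt_nsq_smul, Complex.norm_natCast, hpc]
    nlinarith [Real.sqrt_nonneg (nsq (chi n M i)), Real.sqrt_nonneg (d : ℝ), hn]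
  have h2 := sqrt_nsq_mass_le n M (slabS M i) ha (chi n M i)
  calc _ ≤ 2 * Real.sqrt d * (n : ℝ) ^ 2 * Real.sqrt (nsq (chi n M i)) + a * Real.sqrt (nsq (chi n M i)) := add_le_add h1 h2
    _ = (2 * Real.sqrt d * (n : ℝ) ^ 2 + a) * Real.sqrt (nsq (chi n M i)) := by ring

end Apply

end Summit.QuantumFields.BalabanUV.T4Continuum.DirichletStarSlabLayerEnergy

end
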